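import Summits.KontsevichZagierPeriods.KontsevichZagierPeriods.Theorems.RootDecompWalshStrataEulerDescent10

/-!
# Conic descent, gen 6 (L4 one-variable Euler descent `[T, R(x)·√(ex²+fx+g)^{±1}] ∈ InBaker`), part 11/12

Declarations `InBaker.bezout_split` … `InBaker.sqrt_rational` of the farm-checked gen-6 monolith; see the module docstring of
`EulerDescent01` (part 1) for the overview, the design and the sources. [KontsevichZagier2001 §1.1–1.2; BCR1998 §2.2; Euler 1768; this node gen 4 `sqrtDescent_*`]
-/

noncomputable section

open Literature.NumberTheory.Transcendental
open MeasureTheory Set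
open MvPolynomial (aeval)
open Literature.ModelTheory.ExponentialFields (IsSemialgebraic isSemialgebraic_univ
  isSemialgebraic_setOf_eval_pos isSemialgebraic_setOf_eval_lt isSemialgebraic_setOf_eval_le
  isSemialgebraic_setOf_eval_nonneg isSemialgebraic_setOf_eval_eq_zero continuous_aeval_real
  tarski_seidenberg_real_holds)

namespace Summit.KontsevichZagierPeriods.RootDecompWalshStrata.ConicDescent

/-! #### 24.18 Every `R(x)·√D` with `R ∈ ℚ(x)` regular on the hull -/

/-- BÉZOUT SPLIT (rule (1b)): for coprime `Q₁, Q₂ ∈ ℚ[x]` non-vanishing on the hull,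
`[T, N/(Q₁Q₂)·√D]` is `InBaker` as soon as every `[T', N₁/Q₁·√D]` and every `[T', N₂/Q₂·√D]`
(`T' ⊆ T`) are: `u Q₁ + w Q₂ = 1` gives `N/(Q₁Q₂) = N w/Q₁ + N u/Q₂` (coprime partial
fractions; no degree control is needed). [this node] -/
theorem InBaker.bezout_split (e f g : ℚ) (he : e ≠ 0) (hh : g - f ^ 2 / (4 * e) ≠ 0)
    (N Q₁ Q₂ : Polynomial ℚ) (hcop : IsCoprime Q₁ Q₂) (lo hi : ℚ)
    (hQ₁ : ∀ x : ℝ, (lo : ℝ) ≤ x → x ≤ hi → Polynomial.aeval x Q₁ ≠ 0)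
    (hQ₂ : ∀ x : ℝ, (lo : ℝ) ≤ x → x ≤ hi → Polynomial.aeval x Q₂ ≠ 0)
    (r : KZ.IntegralRep 1) (hdom : ∀ v ∈ r.domain, (lo : ℝ) ≤ v 0 ∧ v 0 ≤ hi)
    (hr : EqOn r.integrand (fun v => Polynomial.aeval (v 0) N /
      (Polynomial.aeval (v 0) Q₁ * Polynomial.aeval (v 0) Q₂) * √(qD e f g (v 0))) r.domain)
    (h₁ : ∀ N₁ : Polynomial ℚ, ∀ r₁ : KZ.IntegralRep 1, r₁.domain ⊆ r.domain →
      EqOn r₁.integrand (fun v => Polynomial.aeval (v 0) N₁ / Polynomial.aeval (v 0) Q₁ *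
        √(qD e f g (v 0))) r₁.domain → InBaker (KZ.of r₁))
    (h₂ : ∀ N₂ : Polynomial ℚ, ∀ r₂ : KZ.IntegralRep 1, r₂.domain ⊆ r.domain →
      EqOn r₂.integrand (fun v => Polynomial.aeval (v 0) N₂ / Polynomial.aeval (v 0) Q₂ *
        √(qD e f g (v 0))) r₂.domain → InBaker (KZ.of r₂)) :
    InBaker (KZ.of r) := by
  have hΔ := disc_ne_zero he hh
  obtain ⟨u, w, huw⟩ := hcop
  refine InBaker.restrict_pos e f g r _ hr fun r₁ hsub hpos hr₁ => ?_
  have hTsub : ∀ v ∈ r₁.domain, (lo : ℝ) ≤ v 0 ∧ v 0 ≤ hi ∧ 0 < qD e f g (v 0) :=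
    fun v hv => ⟨(hdom v (hsub hv)).1, (hdom v (hsub hv)).2, hpos v hv⟩
  have hSA : IsSemialgebraic ℚ r₁.domain := r₁.isSemialgebraic_domain
  -- the part `N w/Q₁ · √D = (N w D/Q₁)/√D` as a representation of its own
  have hcont : ContinuousOn (fun x : ℝ => Polynomial.aeval x (N * w) * qD e f g x /
      Polynomial.aeval x Q₁) (Icc (lo : ℝ) hi) := by
    refine ContinuousOn.div ?_ (Polynomial.continuous_aeval (p := Q₁)).continuousOn
      fun x hx => hQ₁ x hx.1 hx.2
    exact ((Polynomial.continuous_aeval (p := N * w)).mul (by unfold qD; fun_prop)).continuousOn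
  obtain ⟨M, hM⟩ :=
    (isCompact_Icc : IsCompact (Icc (lo : ℝ) hi)).exists_bound_of_continuousOn hcont
  have hF : IsSemialgebraicFunOn ℚ r₁.domain fun v => Polynomial.aeval (v 0) (N * w) *
      qD e f g (v 0) / Polynomial.aeval (v 0) Q₁ :=
    (((IsRatOn.polyAeval (N * w) IsRatOn.coord).mul (IsRatOn.quad e f g)).div
      (IsRatOn.polyAeval Q₁ IsRatOn.coord)
      fun v hv => hQ₁ _ (hTsub v hv).1 (hTsub v hv).2.1).isSemialgebraicFunOn hSA
  obtain ⟨rA, hdomA, hintA⟩ : ∃ rA : KZ.IntegralRep 1, rA.domain = r₁.domain ∧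
      rA.integrand = fun v => Polynomial.aeval (v 0) (N * w) / Polynomial.aeval (v 0) Q₁ *
        √(qD e f g (v 0)) := by
    refine ⟨sqrtDivRep e f g hΔ lo hi r₁.domain hSA hTsub (fun v =>
      Polynomial.aeval (v 0) (N * w) / Polynomial.aeval (v 0) Q₁ * √(qD e f g (v 0))) _ hF M
      (fun v hv => by
      rw [← Real.norm_eq_abs]; exact hM (v 0) ⟨(hTsub v hv).1, (hTsub v hv).2.1⟩)
      (fun v hv => ?_), rfl, rfl⟩
    have hD := hpos v hv
    have hs : √(qD e f g (v 0)) ≠ 0 := (Real.sqrt_pos.2 hD).ne'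
    have hq : Polynomial.aeval (v 0) Q₁ ≠ 0 := hQ₁ _ (hTsub v hv).1 (hTsub v hv).2.1
    rw [eq_div_iff hs, mul_assoc, Real.mul_self_sqrt hD.le]
    field_simp
  have hA : InBaker (KZ.of rA) :=
    h₁ (N * w) rA (fun v hv => hsub (hdomA ▸ hv)) fun v _ => by rw [hintA]
  refine InBaker.of_sub' r₁ rA hdomA hA (h₂ (N * u) (subRep r₁ rA hdomA)
    (fun v hv => hsub hv) fun v hv => ?_)
  have hv' : v ∈ r₁.domain := hv
  have hq₁ : Polynomial.aeval (v 0) Q₁ ≠ 0 := hQ₁ _ (hTsub v hv').1 (hTsub v hv').2.1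
  have hq₂ : Polynomial.aeval (v 0) Q₂ ≠ 0 := hQ₂ _ (hTsub v hv').1 (hTsub v hv').2.1
  have hid : Polynomial.aeval (v 0) u * Polynomial.aeval (v 0) Q₁ +
      Polynomial.aeval (v 0) w * Polynomial.aeval (v 0) Q₂ = 1 := by
    have := congrArg (Polynomial.aeval (v 0)) huw
    simpa only [map_add, map_mul, map_one] using this
  rw [subRep_integrand, hintA, hr₁ hv']
  simp only [map_mul]
  have e1 : Polynomial.aeval (v 0) N / (Polynomial.aeval (v 0) Q₁ * Polynomial.aeval (v 0) Q₂) =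
      Polynomial.aeval (v 0) N * Polynomial.aeval (v 0) w / Polynomial.aeval (v 0) Q₁ +
        Polynomial.aeval (v 0) N * Polynomial.aeval (v 0) u / Polynomial.aeval (v 0) Q₂ := by
    rw [eq_comm, div_add_div _ _ hq₁ hq₂,
      div_eq_div_iff (mul_ne_zero hq₁ hq₂) (mul_ne_zero hq₁ hq₂)]
    linear_combination (Polynomial.aeval (v 0) Q₁ * Polynomial.aeval (v 0) Q₂ *
      Polynomial.aeval (v 0) N) * hid
  rw [e1]
  ring

/-- `X − a` is coprime to every `p` with `p(a) ≠ 0`. [folklore] -/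
theorem isCoprime_X_sub_C_of_eval_ne_zero (p : Polynomial ℚ) (a : ℚ) (h : p.eval a ≠ 0) :
    IsCoprime (Polynomial.X - Polynomial.C a) p :=
  (Polynomial.irreducible_X_sub_C a).coprime_iff_not_dvd.2 fun hd =>
    h (Polynomial.dvd_iff_isRoot.1 hd)

/-- `∏ (X − aᵢ)` is coprime to every `p` with all `p(aᵢ) ≠ 0`. [folklore] -/
theorem isCoprime_prodX_of_eval_ne_zero (l : List ℚ) (p : Polynomial ℚ)
    (h : ∀ a ∈ l, p.eval a ≠ 0) :
    IsCoprime (l.map fun a : ℚ => Polynomial.X - Polynomial.C a).prod p := by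
  induction l with
  | nil => simpa using isCoprime_one_left
  | cons a rest ih =>
    rw [List.map_cons, List.prod_cons]
    exact (isCoprime_X_sub_C_of_eval_ne_zero p a (h a (by simp))).mul_left
      (ih fun b hb => h b (List.mem_cons_of_mem a hb))

/-- The conic polynomial `D₁ = e X² + f X + g ∈ ℚ[X]`. -/
theorem aeval_quadPoly (e f g : ℚ) (x : ℝ) :
    Polynomial.aeval x (Polynomial.C e * Polynomial.X ^ 2 + Polynomial.C f * Polynomial.X +
      Polynomial.C g) = qD e f g x := by
  simp only [map_add, map_mul, Polynomial.aeval_C, Polynomial.aeval_X, map_pow, eq_ratCast, qD]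

/-- A quadratic over `ℚ` without rational roots is coprime to everything it does not divide.
[folklore] -/
theorem isCoprime_quad_of_not_dvd (e f g : ℚ) (he : e ≠ 0)
    (hroots : (Polynomial.C e * Polynomial.X ^ 2 + Polynomial.C f * Polynomial.X +
      Polynomial.C g).roots = 0) (Q₀ : Polynomial ℚ)
    (hnd : ¬ (Polynomial.C e * Polynomial.X ^ 2 + Polynomial.C f * Polynomial.X +
      Polynomial.C g) ∣ Q₀) :
    IsCoprime (Polynomial.C e * Polynomial.X ^ 2 + Polynomial.C f * Polynomial.X +
      Polynomial.C g) Q₀ :=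
  ((Polynomial.irreducible_iff_roots_eq_zero_of_degree_le_three
    (by rw [Polynomial.natDegree_quadratic he])
    (by rw [Polynomial.natDegree_quadratic he]; norm_num)).2 hroots).coprime_iff_not_dvd.2 hnd

/-- Extraction of the exact power of a non-constant `D₁` from `Q ≠ 0`. [folklore] -/
theorem exists_eq_pow_mul_not_dvd (D₁ : Polynomial ℚ) (hD : 0 < D₁.natDegree) :
    ∀ n : ℕ, ∀ Q : Polynomial ℚ, Q ≠ 0 → Q.natDegree ≤ n →
      ∃ m : ℕ, ∃ Q₀ : Polynomial ℚ, Q = D₁ ^ m * Q₀ ∧ ¬ D₁ ∣ Q₀ := by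
  intro n
  induction n with
  | zero =>
    intro Q hQ hdeg
    refine ⟨0, Q, by simp, fun hd => ?_⟩
    have := Polynomial.natDegree_le_of_dvd hd hQ
    omega
  | succ n ih =>
    intro Q hQ hdeg
    by_cases hd : D₁ ∣ Q
    · obtain ⟨Q', rfl⟩ := hd
      have hQ' : Q' ≠ 0 := right_ne_zero_of_mul hQ
      have hD0 : D₁ ≠ 0 := left_ne_zero_of_mul hQ
      have hdeg' : Q'.natDegree ≤ n := by
        have := Polynomial.natDegree_mul hD0 hQ'
        omega
      obtain ⟨m, Q₀, hQ₀, hnd⟩ := ih Q' hQ' hdeg'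
      exact ⟨m + 1, Q₀, by rw [hQ₀, pow_succ]; ring, hnd⟩
    · exact ⟨0, Q, by simp, hd⟩

/-- A rational zero of `aeval · Q` over `ℝ` is a root of `Q`. [folklore] -/
theorem eval_eq_zero_of_aeval_ratCast (Q : Polynomial ℚ) (q : ℚ)
    (h : Polynomial.aeval (q : ℝ) Q = 0) : Q.eval q = 0 := by
  rw [show ((q : ℚ) : ℝ) = algebraMap ℚ ℝ q from (eq_ratCast _ _).symm,
    Polynomial.aeval_algebraMap_apply_eq_algebraMap_eval] at h
  exact (map_eq_zero_iff _ (algebraMap ℚ ℝ).injective).1 h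

/-- NO COMMON REAL ROOT WITH THE CONIC: if `Q₁ ∈ ℚ[X]` has no rational roots, `Q₀ ∣ Q₁` and the
conic polynomial `D₁ = eX² + fX + g` does not divide `Q₀`, then `Q₀` and `D` have no common REAL
root (rational roots of `D` are excluded by `Q₁`, irrational ones by Bézout with the then
irreducible `D₁`). [folklore] -/
theorem qD_ne_zero_of_aeval_eq_zero (e f g : ℚ) (he : e ≠ 0) (Q₁ Q₀ : Polynomial ℚ)
    (hQ₁0 : Q₁ ≠ 0) (hroots : Q₁.roots = 0) (hdvd : Q₀ ∣ Q₁)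
    (hnd : ¬ (Polynomial.C e * Polynomial.X ^ 2 + Polynomial.C f * Polynomial.X +
      Polynomial.C g) ∣ Q₀) (ρ : ℝ) (hρ : Polynomial.aeval ρ Q₀ = 0) : qD e f g ρ ≠ 0 := by
  intro hD
  have hQ₀0 : Q₀ ≠ 0 := by rintro rfl; exact hQ₁0 (zero_dvd_iff.1 hdvd)
  -- no rational root of `Q₀`
  have hnorat : ∀ q : ℚ, Polynomial.aeval (q : ℝ) Q₀ ≠ 0 := by
    intro q hq
    have hmem : q ∈ Q₀.roots :=
      (Polynomial.mem_roots hQ₀0).2 (eval_eq_zero_of_aeval_ratCast Q₀ q hq)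
    have := Polynomial.roots.le_of_dvd hQ₁0 hdvd
    rw [hroots, Multiset.le_zero] at this
    rw [this] at hmem
    exact absurd hmem (by simp)
  by_cases hDr : (Polynomial.C e * Polynomial.X ^ 2 + Polynomial.C f * Polynomial.X +
      Polynomial.C g).roots = 0
  · -- `D₁` irreducible over `ℚ`: Bézout, evaluated at `ρ`
    obtain ⟨u, w, huw⟩ := isCoprime_quad_of_not_dvd e f g he hDr Q₀ hnd
    have := congrArg (Polynomial.aeval ρ) huw
    rw [map_add, map_mul, map_mul, map_one, aeval_quadPoly, hD, hρ, mul_zero, mul_zero,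
      add_zero] at this
    exact zero_ne_one this
  · -- `D₁` has a rational root `θ`; then `ρ ∈ {θ, −f/e − θ}` is rational
    obtain ⟨θ, hθ⟩ := Multiset.exists_mem_of_ne_zero hDr
    have hθr : e * θ ^ 2 + f * θ + g = 0 := by
      have := Polynomial.isRoot_of_mem_roots hθ
      simpa [Polynomial.IsRoot] using this
    have hθr' : (e : ℝ) * θ ^ 2 + f * θ + g = 0 := by exact_mod_cast hθr
    have he' : (e : ℝ) ≠ 0 := by exact_mod_cast he
    have hfac : (ρ - θ) * ((e : ℝ) * ρ + f + e * θ) = 0 := by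
      simp only [qD] at hD
      have : (e : ℝ) * ((ρ - θ) * ((e : ℝ) * ρ + f + e * θ)) = 0 := by
        linear_combination e * hD - e * hθr'
      exact (mul_eq_zero.1 this).resolve_left he'
    rcases mul_eq_zero.1 hfac with h1 | h2
    · exact hnorat θ (by rwa [show ρ = (θ : ℝ) by linarith] at hρ)
    · refine hnorat (-f / e - θ) ?_
      have hρ' : ρ = (((-f / e - θ : ℚ)) : ℝ) := by
        push_cast
        rw [eq_sub_iff_add_eq, eq_div_iff he']
        linear_combination h2
      rwa [hρ'] at hρ

/-- A uniform positive rational distance from `[lo, hi]` to finitely many rationals outside it.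
[folklore] -/
theorem exists_sep_of_forall_not_mem (lo hi : ℚ) (l : List ℚ) (h : ∀ a ∈ l, a < lo ∨ hi < a) :
    ∃ δ : ℚ, 0 < δ ∧ ∀ a ∈ l, ∀ x : ℝ, (lo : ℝ) ≤ x → x ≤ hi → (δ : ℝ) ≤ |x - a| := by
  induction l with
  | nil => exact ⟨1, one_pos, fun a ha => by simp at ha⟩
  | cons a rest ih =>
    obtain ⟨δ', hδ', hsep'⟩ := ih fun b hb => h b (List.mem_cons_of_mem a hb)
    obtain ⟨d, hd, hda⟩ : ∃ d : ℚ, 0 < d ∧ ∀ x : ℝ, (lo : ℝ) ≤ x → x ≤ hi → (d : ℝ) ≤ |x - a| := by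
      rcases h a (by simp) with ha | ha
      · refine ⟨lo - a, by linarith, fun x hx1 _ => ?_⟩
        have ha' : (a : ℝ) < lo := by exact_mod_cast ha
        rw [abs_of_pos (by linarith)]; push_cast; linarith
      · refine ⟨a - hi, by linarith, fun x _ hx2 => ?_⟩
        have ha' : (hi : ℝ) < a := by exact_mod_cast ha
        rw [abs_of_neg (by linarith)]; push_cast; linarith
    refine ⟨min δ' d, lt_min hδ' hd, fun b hb x hx1 hx2 => ?_⟩
    rcases List.mem_cons.1 hb with rfl | hb
    · exact le_trans (by exact_mod_cast min_le_right _ _) (hda x hx1 hx2)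
    · exact le_trans (by exact_mod_cast min_le_left _ _) (hsep' b hb x hx1 hx2)

/-- **L4 — THE ONE-VARIABLE EULER DESCENT IN THE BAKER SECTOR (capstone).**
`[T, R(x)·√(e x² + f x + g)] ∈ InBaker` for `e ≠ 0`, `h = g − f²/(4e) ≠ 0`, and EVERY rational
function `R = N/Q ∈ ℚ(x)` whose denominator does not vanish on a compact rational hull
`[lo, hi] ⊇ T` (equivalently: the integrand is a continuous function `R·√D`, `R ∈ ℚ(x)`, on the
closure of the bounded domain `T`).  PROOF (the full algorithm of this node, assembled):
factor `Q = ∏(X − aᵢ)^{kᵢ} · D₁^m · Q₀` over `ℚ` (`aᵢ` the rational roots, `D₁ = eX² + fX + g`,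
`Q₀` without rational roots and prime to `D₁`); the three factors are pairwise coprime, so two
Bézout splits (`InBaker.bezout_split`) reduce to: rational poles of any multiplicity, all at
distance `≥ δ > 0` from the hull — `InBaker.rat_factor_mult`; the conic power `N/D₁^m · √D` —
the vertex Euler chart `InBaker.euler_factor` (`D₁` is symmetric about the vertex); and the
generic part `N/Q₀ · √D` — the Möbius dispatcher `InBaker.euler_full` (`Q₀` has no real root on
`D = 0` by `qD_ne_zero_of_aeval_eq_zero`).  This is lemma L4 of the lineage design in its final
form; only the degenerate radicands (`e = 0` or `h = 0`, i.e. `R(x)√(ax+b)` and `R(x)·|x − x₀|`,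
which are `IsRational` after the obvious substitution) lie outside its hypotheses. [this node] -/
theorem InBaker.sqrt_rational (e f g : ℚ) (he : e ≠ 0) (hh : g - f ^ 2 / (4 * e) ≠ 0)
    (N Q : Polynomial ℚ) (lo hi : ℚ)
    (hQ : ∀ x : ℝ, (lo : ℝ) ≤ x → x ≤ hi → Polynomial.aeval x Q ≠ 0)
    (r : KZ.IntegralRep 1) (hdom : ∀ v ∈ r.domain, (lo : ℝ) ≤ v 0 ∧ v 0 ≤ hi)
    (hr : EqOn r.integrand (fun v => Polynomial.aeval (v 0) N / Polynomial.aeval (v 0) Q *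
      √(qD e f g (v 0))) r.domain) :
    InBaker (KZ.of r) := by
  classical
  rcases lt_or_ge hi lo with hhl | hlh
  · -- empty hull
    have hempty : r.domain = ∅ := by
      ext v
      simp only [mem_empty_iff_false, iff_false]
      intro hv
      have h1 := hdom v hv
      have h2 : (hi : ℝ) < lo := by exact_mod_cast hhl
      linarith [h1.1, h1.2]
    exact InBaker.of_mem_relations
      (KZ.of_mem_relations_of_volume_eq_zero _ (by rw [hempty, measure_empty]))
  have hlh' : (lo : ℝ) ≤ hi := by exact_mod_cast hlh
  have hQ0 : Q ≠ 0 := by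
    intro h; apply hQ lo le_rfl hlh'; rw [h, map_zero]
  -- (1) the rational roots: `Q = L · Q₁`, `Q₁` without rational roots
  obtain ⟨Q₁, hLQ, -, hQ₁roots⟩ := Q.exists_prod_multiset_X_sub_C_mul
  set poles : List ℚ := Q.roots.toList with hpoles
  set L : Polynomial ℚ := (poles.map fun a : ℚ => Polynomial.X - Polynomial.C a).prod with hLdef
  have hL : (Q.roots.map fun a => Polynomial.X - Polynomial.C a).prod = L := by
    rw [hLdef, hpoles, Multiset.prod_map_toList]
  have hQfac : Q = L * Q₁ := by rw [← hL]; exact hLQ.symm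
  have hQ₁0 : Q₁ ≠ 0 := by
    intro h; rw [h, mul_zero] at hQfac; exact hQ0 hQfac
  -- (2) the conic factor: `Q₁ = D₁^m · Q₀`, `D₁ ∤ Q₀`
  set D₁ : Polynomial ℚ := Polynomial.C e * Polynomial.X ^ 2 + Polynomial.C f * Polynomial.X +
    Polynomial.C g with hD₁def
  have hD₁deg : D₁.natDegree = 2 := Polynomial.natDegree_quadratic he
  have hD₁0 : D₁ ≠ 0 := by
    intro h; rw [h, Polynomial.natDegree_zero] at hD₁deg; exact absurd hD₁deg (by norm_num)
  obtain ⟨m, Q₀, hQ₁fac, hnd⟩ :=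
    exists_eq_pow_mul_not_dvd D₁ (by rw [hD₁deg]; norm_num) Q₁.natDegree Q₁ hQ₁0 le_rfl
  have hQ₀0 : Q₀ ≠ 0 := by
    intro h; rw [h, mul_zero] at hQ₁fac; exact hQ₁0 hQ₁fac
  have hQ₀dvd : Q₀ ∣ Q₁ := ⟨D₁ ^ m, by rw [hQ₁fac, mul_comm]⟩
  -- values on the hull
  have hQv : ∀ x : ℝ, Polynomial.aeval x Q =
      Polynomial.aeval x L * (Polynomial.aeval x D₁ ^ m * Polynomial.aeval x Q₀) := by
    intro x; rw [hQfac, hQ₁fac, map_mul, map_mul, map_pow]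
  have hhull : ∀ x : ℝ, (lo : ℝ) ≤ x → x ≤ hi → Polynomial.aeval x L ≠ 0 ∧
      Polynomial.aeval x D₁ ^ m ≠ 0 ∧ Polynomial.aeval x Q₀ ≠ 0 := by
    intro x h1 h2
    have h := hQ x h1 h2
    rw [hQv x] at h
    exact ⟨(mul_ne_zero_iff.1 h).1, (mul_ne_zero_iff.1 (mul_ne_zero_iff.1 h).2).1,
      (mul_ne_zero_iff.1 (mul_ne_zero_iff.1 h).2).2⟩
  -- rational evaluations
  have hQ₁eval : ∀ a : ℚ, Q₁.eval a ≠ 0 := by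
    intro a ha
    have : a ∈ Q₁.roots := (Polynomial.mem_roots hQ₁0).2 ha
    rw [hQ₁roots] at this
    exact absurd this (by simp)
  have hQ₀eval : ∀ a : ℚ, Q₀.eval a ≠ 0 := by
    intro a ha
    apply hQ₁eval a
    rw [hQ₁fac, Polynomial.eval_mul, ha, mul_zero]
  have hD₁eval : 1 ≤ m → ∀ a : ℚ, D₁.eval a ≠ 0 := by
    intro hm a ha
    apply hQ₁eval a
    rw [hQ₁fac, Polynomial.eval_mul, Polynomial.eval_pow, ha, zero_pow (by omega), zero_mul]
  -- the poles lie outside the hull, at a uniform distance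
  have hpoles_out : ∀ a ∈ poles, a < lo ∨ hi < a := by
    intro a ha
    rw [hpoles, Multiset.mem_toList] at ha
    have hroot : Q.eval a = 0 := (Polynomial.mem_roots hQ0).1 ha
    by_contra hcon
    push Not at hcon
    apply hQ a (by exact_mod_cast hcon.1) (by exact_mod_cast hcon.2)
    rw [show ((a : ℚ) : ℝ) = algebraMap ℚ ℝ a from (eq_ratCast _ _).symm,
      Polynomial.aeval_algebraMap_apply_eq_algebraMap_eval, hroot, map_zero]
  obtain ⟨δ, hδ, hsep⟩ := exists_sep_of_forall_not_mem lo hi poles hpoles_out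
  -- (3) coprimality
  have hcopL : IsCoprime L (D₁ ^ m * Q₀) := by
    refine IsCoprime.mul_right ?_
      (isCoprime_prodX_of_eval_ne_zero poles Q₀ fun a _ => hQ₀eval a)
    rcases Nat.eq_zero_or_pos m with hm | hm
    · rw [hm, pow_zero]; exact isCoprime_one_right
    · exact (isCoprime_prodX_of_eval_ne_zero poles D₁ fun a _ => hD₁eval hm a).pow_right
  have hcopD : IsCoprime (D₁ ^ m) Q₀ := by
    rcases Nat.eq_zero_or_pos m with hm | hm
    · rw [hm, pow_zero]; exact isCoprime_one_left
    · refine (isCoprime_quad_of_not_dvd e f g he ?_ Q₀ hnd).pow_left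
      exact Multiset.eq_zero_of_forall_notMem fun a ha =>
        hD₁eval hm a ((Polynomial.mem_roots hD₁0).1 ha)
  -- (4) `Q₀` has no real root on the conic
  have hQD : ∀ ρ : ℝ, Polynomial.aeval ρ Q₀ = 0 → qD e f g ρ ≠ 0 :=
    qD_ne_zero_of_aeval_eq_zero e f g he Q₁ Q₀ hQ₁0 hQ₁roots hQ₀dvd hnd
  -- (5) assembly: two Bézout splits
  have hrL : EqOn r.integrand (fun v => Polynomial.aeval (v 0) N /
      (Polynomial.aeval (v 0) L * Polynomial.aeval (v 0) (D₁ ^ m * Q₀)) * √(qD e f g (v 0)))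
      r.domain := by
    intro v hv
    rw [hr hv]
    simp only [map_mul, map_pow, hQv]
  refine InBaker.bezout_split e f g he hh N L (D₁ ^ m * Q₀) hcopL lo hi
    (fun x h1 h2 => (hhull x h1 h2).1)
    (fun x h1 h2 => by
      rw [map_mul, map_pow]; exact mul_ne_zero (hhull x h1 h2).2.1 (hhull x h1 h2).2.2)
    r hdom hrL (fun N₁ r₁ hsub₁ hr₁ => ?_) (fun N₂ r₂ hsub₂ hr₂ => ?_)
  · -- the rational poles
    refine InBaker.rat_factor_mult e f g he hh 1 lo hi δ hδ (fun x _ _ => by simp) poles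
      (fun a _ => by simp) N₁ r₁ (fun v hv => hdom v (hsub₁ hv))
      (fun v hv a ha _ => hsep a ha (v 0) (hdom v (hsub₁ hv)).1 (hdom v (hsub₁ hv)).2)
      fun v hv => ?_
    rw [hr₁ hv]
    simp only [map_one, one_mul, hLdef, aeval_prodX]
  · -- the conic power and the generic part
    refine InBaker.bezout_split e f g he hh N₂ (D₁ ^ m) Q₀ hcopD lo hi
      (fun x h1 h2 => by rw [map_pow]; exact (hhull x h1 h2).2.1)
      (fun x h1 h2 => (hhull x h1 h2).2.2) r₂ (fun v hv => hdom v (hsub₂ hv))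
      (fun v hv => by rw [hr₂ hv]; simp only [map_mul])
      (fun N₃ r₃ hsub₃ hr₃ => ?_) (fun N₄ r₄ hsub₄ hr₄ => ?_)
    · -- `N₃/D₁^m · √D`: vertex Euler chart (`D₁` is symmetric about the vertex)
      refine InBaker.euler_factor e f g he hh N₃ (D₁ ^ m) lo hi r₃
        (fun v hv => hdom v (hsub₂ (hsub₃ hv))) (fun x h1 h2 => ?_) hr₃
      rcases Nat.eq_zero_or_pos m with hm | hm
      · simp [hm]
      · have hDx : Polynomial.aeval x D₁ ≠ 0 := ne_zero_pow hm.ne' (hhull x h1 h2).2.1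
        have hDx' : qD e f g x ≠ 0 := by rwa [hD₁def, aeval_quadPoly] at hDx
        refine ⟨by rw [map_pow]; exact pow_ne_zero _ hDx, ?_⟩
        rw [map_pow, hD₁def, aeval_quadPoly, qD_reflect e f g he]
        exact pow_ne_zero _ hDx'
    · -- `N₄/Q₀ · √D`: the Möbius dispatcher
      exact InBaker.euler_full e f g he hh N₄ Q₀ lo hi (fun x h1 h2 => (hhull x h1 h2).2.2) hQD
        r₄ (fun v hv => hdom v (hsub₂ (hsub₄ hv))) hr₄

end Summit.KontsevichZagierPeriods.RootDecompWalshStrata.ConicDescent
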